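import Summits.AtomisticToContinuum.Crystallization.Theorems.PricedLinkCensusLocalToGlobalFccMirrorGeometry

/-!
# The facet reflections of the rhombic dodecahedron, on `ℝ³`, on `fcc(a)` and on `ℝ⁸`

Route `PricedLinkCensus`, crux `LocalToGlobal` (stmt-AtomisticToContinuum-14232), line
`flux-cell-joint-census`, support for the registered stub `stub_fccMirrorExact : NewtonShell8 → FccMirrorExact`
(`Theorems/PricedLinkCensusLocalToGlobalDefs`), second half (`fluxCell ≤ S₆`, the method of images).  The
twelve facet planes `{x : 2⟪x, w⟫ = ‖w‖²}` of the Voronoi cell of `fcc(a)` (`w ∈ fcc(a)`, `‖w‖ = a`) are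
MIRRORS of the point set `fcc(a)`.  Here, for a real inner product space `F`:

* the Householder reflection `reflL v = id - (2/‖v‖²) ⟪v, ·⟫ v` (a continuous linear involutive isometry,
  self-adjoint, `reflL v v = -v`, identity on `v^⊥`);
* the affine FACET REFLECTION `facetRefl w x = reflL w x + w` of `ℝ³` in the plane `2⟪x, w⟫ = ‖w‖²` and its lift
  `facetRefl8 w z = reflL (emb w) z + emb w` to `ℝ⁸` (acting on the first three coordinates): involutions,
  `proj ∘ facetRefl8 w = facetRefl w ∘ proj`, differences are reflected (`facetRefl8 w z - facetRefl8 w z' =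
  reflL (emb w) (z - z')`), the facet functional `‖w‖² - 2⟪x, w⟫` changes sign, points of the plane are fixed;
* `facetRefl w` maps `fcc(a)` onto itself for `w ∈ fcc(a)` with `‖w‖ = a` (`facetRefl_mem_fccSet`: with
  `x = (a/√2)n`, `w = (a/√2)m`, `facetRefl w x = (a/√2)(n + (1 - n·m) m)` and `Σ mₖ` is even), whence the
  permutation `facetReflEquiv` of the index type `↥(fccSet a)` of the lattice sums of the method of images.

References: J. H. Conway, N. J. A. Sloane, *Sphere packings, lattices and groups* (1999), Ch. 4 §6.2, Ch. 21
(the Voronoi cell of `D₃` and its symmetries); folklore.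
-/

noncomputable section

open scoped BigOperators RealInnerProductSpace Pointwise
open MeasureTheory Metric Set Filter Function Literature.Geometry.DiscreteGeometry

namespace Summit.AtomisticToContinuum.Crystallization.Theorems.PricedLinkCensusLocalToGlobal

/-! ### The Householder reflection -/

section Householder

variable {F : Type*} [NormedAddCommGroup F] [InnerProductSpace ℝ F]

/-- THE HOUSEHOLDER REFLECTION `x ↦ x - (2⟪v, x⟫/‖v‖²) v` orthogonal to `v` (the identity for `v = 0`), as a
continuous linear map. [folklore] -/
def reflL (v : F) : F →L[ℝ] F := ContinuousLinearMap.id ℝ F - (2 / ‖v‖ ^ 2) • (innerSL ℝ v).smulRight v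

/-- The formula. [folklore] -/
theorem reflL_apply (v x : F) : reflL v x = x - (2 * ⟪x, v⟫ / ‖v‖ ^ 2) • v := by
  show x - (2 / ‖v‖ ^ 2) • (⟪v, x⟫ • v) = _
  rw [smul_smul, real_inner_comm v x, div_mul_eq_mul_div]

/-- `reflL v v = -v` (`v ≠ 0`). [folklore] -/
theorem reflL_self {v : F} (hv : v ≠ 0) : reflL v v = -v := by
  have h : ‖v‖ ^ 2 ≠ 0 := pow_ne_zero 2 (norm_ne_zero_iff.2 hv)
  rw [reflL_apply, real_inner_self_eq_norm_sq, mul_div_assoc, div_self h, mul_one, two_smul]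
  abel

/-- Vectors orthogonal to `v` are fixed. [folklore] -/
theorem reflL_of_inner_eq_zero {v x : F} (h : ⟪x, v⟫ = 0) : reflL v x = x := by
  rw [reflL_apply, h, mul_zero, zero_div, zero_smul, sub_zero]

/-- The `v`-component changes sign: `⟪reflL v x, v⟫ = -⟪x, v⟫`. [folklore] -/
theorem inner_reflL_self (v x : F) : ⟪reflL v x, v⟫ = -⟪x, v⟫ := by
  by_cases hv : v = 0
  · simp [hv]
  have h : ‖v‖ ^ 2 ≠ 0 := pow_ne_zero 2 (norm_ne_zero_iff.2 hv)
  rw [reflL_apply, inner_sub_left, inner_smul_left, real_inner_self_eq_norm_sq, RCLike.conj_to_real,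
    div_mul_cancel₀ _ h]
  ring

/-- `reflL v` is self-adjoint. [folklore] -/
theorem inner_reflL_left (v x y : F) : ⟪reflL v x, y⟫ = ⟪x, reflL v y⟫ := by
  rw [reflL_apply, reflL_apply, inner_sub_left, inner_sub_right, inner_smul_left, inner_smul_right,
    RCLike.conj_to_real, real_inner_comm v y]
  ring

/-- `reflL v` is an involution. [folklore] -/
theorem reflL_reflL (v x : F) : reflL v (reflL v x) = x := by
  by_cases hv : v = 0
  · simp [reflL_apply, hv]
  have h : ‖v‖ ^ 2 ≠ 0 := pow_ne_zero 2 (norm_ne_zero_iff.2 hv)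
  rw [reflL_apply, inner_reflL_self, reflL_apply, sub_sub, ← add_smul]
  have : 2 * ⟪x, v⟫ / ‖v‖ ^ 2 + 2 * -⟪x, v⟫ / ‖v‖ ^ 2 = 0 := by ring
  rw [this, zero_smul, sub_zero]

/-- `reflL v` is involutive. [folklore] -/
theorem reflL_involutive (v : F) : Involutive (reflL v) := reflL_reflL v

/-- `reflL v` preserves inner products. [folklore] -/
theorem inner_reflL_reflL (v x y : F) : ⟪reflL v x, reflL v y⟫ = ⟪x, y⟫ := by
  rw [inner_reflL_left, reflL_reflL]

/-- `reflL v` is an isometry: `‖reflL v x‖ = ‖x‖`. [folklore] -/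
theorem norm_reflL (v x : F) : ‖reflL v x‖ = ‖x‖ := by
  rw [← sq_eq_sq₀ (norm_nonneg _) (norm_nonneg _), ← real_inner_self_eq_norm_sq, inner_reflL_reflL,
    real_inner_self_eq_norm_sq]

end Householder

/-! ### The facet reflections of `ℝ³` and their lifts to `ℝ⁸` -/

/-- THE FACET REFLECTION of `ℝ³` in the plane `{x : 2⟪x, w⟫ = ‖w‖²}` (the perpendicular bisector of `[0, w]`):
`x ↦ reflL w x + w`. [folklore] -/
def facetRefl (w x : E3) : E3 := reflL w x + w

/-- Its lift to `ℝ⁸`, acting on the first three coordinates: `z ↦ reflL (ι w) z + ι w`. [folklore] -/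
def facetRefl8 (w : E3) (z : E8) : E8 := reflL (emb w) z + emb w

/-- `⟪z, ι w⟫ = ⟪proj z, w⟫` (`ι w` has no transverse part). [folklore] -/
theorem inner_emb_right (z : E8) (w : E3) : ⟪z, emb w⟫ = ⟪proj z, w⟫ := by
  rw [PiLp.inner_apply, PiLp.inner_apply, sum_fin8_split]
  simp [emb_apply_castAdd, emb_apply_natAdd, proj_apply]

/-- `⟪ι u, ι w⟫ = ⟪u, w⟫`. [folklore] -/
theorem inner_emb_emb (u w : E3) : ⟪emb u, emb w⟫ = ⟪u, w⟫ := by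
  rw [inner_emb_right, proj_emb]

/-- `proj` is additive. [folklore] -/
theorem proj_add (z z' : E8) : proj (z + z') = proj z + proj z' := map_add projL z z'

/-- `proj` is subtractive. [folklore] -/
theorem proj_sub (z z' : E8) : proj (z - z') = proj z - proj z' := map_sub projL z z'

/-- `proj` is homogeneous. [folklore] -/
theorem proj_smul (c : ℝ) (z : E8) : proj (c • z) = c • proj z := map_smul projL c z

/-- `emb` is homogeneous. [folklore] -/
theorem emb_smul (c : ℝ) (x : E3) : emb (c • x) = c • emb x := map_smul embL c x

/-- `proj` intertwines the reflections: `proj (reflL (ι w) z) = reflL w (proj z)`. [folklore] -/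
theorem proj_reflL (w : E3) (z : E8) : proj (reflL (emb w) z) = reflL w (proj z) := by
  rw [reflL_apply, reflL_apply, proj_sub, proj_smul, proj_emb, inner_emb_right, norm_emb]

/-- `proj (facetRefl8 w z) = facetRefl w (proj z)`. [folklore] -/
theorem proj_facetRefl8 (w : E3) (z : E8) : proj (facetRefl8 w z) = facetRefl w (proj z) := by
  rw [facetRefl8, facetRefl, proj_add, proj_reflL, proj_emb]

/-- The lift acts on `ι(ℝ³)` as the reflection of `ℝ³`: `facetRefl8 w (ι x) = ι (facetRefl w x)`. [folklore] -/
theorem facetRefl8_emb (w x : E3) : facetRefl8 w (emb x) = emb (facetRefl w x) := by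
  rw [facetRefl8, facetRefl, reflL_apply, reflL_apply, inner_emb_emb, norm_emb, emb_add, ← emb_sub, emb_smul]

/-- Differences are reflected linearly: `facetRefl8 w z - facetRefl8 w z' = reflL (ι w) (z - z')`. [folklore] -/
theorem facetRefl8_sub (w : E3) (z z' : E8) : facetRefl8 w z - facetRefl8 w z' = reflL (emb w) (z - z') := by
  rw [facetRefl8, facetRefl8, map_sub, add_sub_add_right_eq_sub]

/-- Differences are reflected linearly (`ℝ³`). [folklore] -/
theorem facetRefl_sub (w x x' : E3) : facetRefl w x - facetRefl w x' = reflL w (x - x') := by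
  rw [facetRefl, facetRefl, map_sub, add_sub_add_right_eq_sub]

/-- `facetRefl w` is an involution (`w ≠ 0`). [folklore] -/
theorem facetRefl_facetRefl {w : E3} (hw : w ≠ 0) (x : E3) : facetRefl w (facetRefl w x) = x := by
  rw [facetRefl, facetRefl, map_add, reflL_reflL, reflL_self hw, neg_add_cancel_right]

/-- `facetRefl8 w` is an involution (`w ≠ 0`). [folklore] -/
theorem facetRefl8_facetRefl8 {w : E3} (hw : w ≠ 0) (z : E8) : facetRefl8 w (facetRefl8 w z) = z := by
  have hw' : emb w ≠ 0 := fun h => hw (by rw [← proj_emb w, h]; exact map_zero projL)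
  rw [facetRefl8, facetRefl8, map_add, reflL_reflL, reflL_self hw', neg_add_cancel_right]

/-- **The facet functional changes sign**: `‖w‖² - 2⟪facetRefl w x, w⟫ = -(‖w‖² - 2⟪x, w⟫)`. [folklore] -/
theorem facetFn_facetRefl (w x : E3) : ‖w‖ ^ 2 - 2 * ⟪facetRefl w x, w⟫ = -(‖w‖ ^ 2 - 2 * ⟪x, w⟫) := by
  rw [facetRefl, inner_add_left, inner_reflL_self, real_inner_self_eq_norm_sq]
  ring

/-- **Points of the facet plane are fixed**: `2⟪proj z, w⟫ = ‖w‖² → facetRefl8 w z = z`. [folklore] -/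
theorem facetRefl8_of_mem_plane {w : E3} {z : E8} (hz : 2 * ⟪proj z, w⟫ = ‖w‖ ^ 2) : facetRefl8 w z = z := by
  by_cases hw : w = 0
  · rw [facetRefl8, hw, emb_zero]; simp [reflL_apply]
  have h : ‖w‖ ^ 2 ≠ 0 := pow_ne_zero 2 (norm_ne_zero_iff.2 hw)
  rw [facetRefl8, reflL_apply, inner_emb_right, norm_emb, hz, div_self h, one_smul, sub_add_cancel]

/-- **Normal components vanish on a mirror**: if a vector is reflected into itself by `reflL (ι w)`, its
`ι w`-component is zero. [folklore] -/
theorem inner_eq_zero_of_reflL_eq {w : E3} {G : E8} (h : reflL (emb w) G = G) : ⟪G, emb w⟫ = 0 := by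
  have := inner_reflL_self (emb w) G
  rw [h] at this
  linarith

/-! ### The facet reflections permute `fcc(a)` -/

/-- `⟪(a/√2)n, (a/√2)m⟫ = (a²/2) Σ nₖ mₖ`. [folklore] -/
theorem inner_smul_intVec (a : ℝ) (n m : Fin 3 → ℤ) :
    ⟪(a / Real.sqrt 2) • intVec n, (a / Real.sqrt 2) • intVec m⟫ = a ^ 2 / 2 * ∑ k, ((n k : ℝ) * m k) := by
  rw [inner_smul_left, inner_smul_right, inner_intVec_right, RCLike.conj_to_real, ← mul_assoc, div_mul_div_comm,
    Real.mul_self_sqrt two_pos.le, ← sq]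
  simp [intVec_apply]

/-- **Facet reflections map `fcc(a)` to itself** (`w ∈ fcc(a)`, `‖w‖ = a > 0`): with `x = (a/√2)n`,
`w = (a/√2)m`, `facetRefl w x = (a/√2)(n + (1 - Σ nₖmₖ) m)`, and `Σ mₖ` is even. [folklore] -/
theorem facetRefl_mem_fccSet {a : ℝ} (ha : 0 < a) {w x : E3} (hw : w ∈ fccSet a) (hwa : ‖w‖ = a)
    (hx : x ∈ fccSet a) : facetRefl w x ∈ fccSet a := by
  obtain ⟨m, hm, rfl⟩ := mem_fccSet_iff.1 hw
  obtain ⟨n, hn, rfl⟩ := mem_fccSet_iff.1 hx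
  set N : ℤ := ∑ k, n k * m k with hN
  have ha2 : a ^ 2 ≠ 0 := pow_ne_zero 2 ha.ne'
  have hcoef : 2 * ⟪(a / Real.sqrt 2) • intVec n, (a / Real.sqrt 2) • intVec m⟫ / ‖(a / Real.sqrt 2) • intVec m‖ ^ 2
      = (N : ℝ) := by
    rw [hwa, inner_smul_intVec, hN]
    push_cast
    field_simp
  refine mem_fccSet_iff.2 ⟨n + (1 - N) • m, ?_, ?_⟩
  · simp only [Pi.add_apply, Pi.smul_apply, smul_eq_mul, Finset.sum_add_distrib, ← Finset.mul_sum]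
    exact hn.add (hm.mul_left _)
  · rw [facetRefl, reflL_apply, hcoef, ← smul_assoc, smul_eq_mul, mul_comm (N : ℝ), ← smul_eq_mul, smul_assoc,
      ← smul_sub, ← smul_add]
    congr 1
    ext k
    simp only [intVec_apply, PiLp.add_apply, PiLp.sub_apply, PiLp.smul_apply, smul_eq_mul, Pi.add_apply,
      Pi.smul_apply, Int.cast_add, Int.cast_mul, Int.cast_sub, Int.cast_one]
    ring

/-- The minimal vectors are nonzero (`‖w‖ = a > 0`). [folklore] -/
theorem ne_zero_of_norm_eq {a : ℝ} (ha : 0 < a) {w : E3} (hwa : ‖w‖ = a) : w ≠ 0 := fun h => by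
  rw [h, norm_zero] at hwa; exact ha.ne hwa

/-- **The permutation of `fcc(a)` induced by a facet reflection** (an involution of the index type of the
lattice sums). [folklore] -/
def facetReflEquiv {a : ℝ} (ha : 0 < a) {w : E3} (hw : w ∈ fccSet a) (hwa : ‖w‖ = a) : fccSet a ≃ fccSet a :=
  Function.Involutive.toPerm (fun p => ⟨facetRefl w p.1, facetRefl_mem_fccSet ha hw hwa p.2⟩) fun p =>
    Subtype.ext (facetRefl_facetRefl (ne_zero_of_norm_eq ha hwa) p.1)

/-- The permutation acts by the reflection. [folklore] -/
@[simp] theorem facetReflEquiv_apply {a : ℝ} (ha : 0 < a) {w : E3} (hw : w ∈ fccSet a) (hwa : ‖w‖ = a)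
    (p : fccSet a) : (facetReflEquiv ha hw hwa p : E3) = facetRefl w p := rfl

/-- **Registered sub-goal `fccMirror_facetRefl_mem`** (line `flux-cell-joint-census`, support of
`stub_fccMirrorExact`): the facet planes of the rhombic dodecahedron are mirrors of `fcc(a)`, binder form of
`facetRefl_mem_fccSet`. [folklore] -/
theorem fccMirror_facetRefl_mem : ∀ (a : ℝ), 0 < a → ∀ w ∈ fccSet a, ‖w‖ = a →
    ∀ x ∈ fccSet a, facetRefl w x ∈ fccSet a :=
  fun _ ha _ hw hwa _ hx => facetRefl_mem_fccSet ha hw hwa hx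

end Summit.AtomisticToContinuum.Crystallization.Theorems.PricedLinkCensusLocalToGlobal

end
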